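import Summits.CriticalPhenomena.SAWScalingLimit.Theorems.SAWTotalPositivityBoundaryHarnack
import Summits.CriticalPhenomena.SAWScalingLimit.Theorems.SAWLeftRightFKGFKGToTraversalBoundGatesDefs
import HarnessLib

/-!
# Gate excision, part 1: the two-point function of `Ω_δ` along a walk (splitting induction)

Crux `SAWLeftRightFKG.FKGToTraversalBound` (stmt-CriticalPhenomena-1878), line
`gates-by-bubble-doors-by-fkg`, registered helper `gateExcision_twoPoint_le` of the stub
`stub_gateExcision` (the gate lemma `CriticalBubbleBound → ∀ w₀, GatedPocketBound w₀`).

The SPLITTING INDUCTION from the adjacent-pair bubble: if every pair of `ℤ²`-neighbours `u ∼ v` has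
critical two-point function `Z_Ω(u,v) = SAW.weight Ω δ u v univ ≤ C₀` in the discrete domain `Ω_δ`, then
for every walk `p : t → s` of `Ω_δ` of length `n`,
`Z_Ω(t,s) ≤ (x_c⁻¹ + C₀)ⁿ`
(`gateExcision_twoPoint_le`): peel the last edge `r s` of `p` and use the hypothesis-free one-step
bound `Z(t,s) ≤ (x_c⁻¹ + Z(r,s)) · Z(t,r)` of `BoundaryHarnack.weight_le_of_adj` (split a chord
`t → s` at its unique visit of `r`, or append the edge `s r`), with `Z(t,t) = 1`.

Consequence for a lattice box `Q` of side `w` (`InBox q w`, `(w+1)²` sites, `card_le_of_inBox`):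
two sites joined by a walk of `Ω_δ` inside `Q` are joined by a self-avoiding one with at most
`(w+1)² - 1` edges, so their two-point function is at most `(x_c⁻¹ + C₀)^{(w+1)²-1}`
(`weight_univ_le_pow_of_inBox`).  Only theorems; no named fact; axioms are the standard three.
-/

noncomputable section

open MeasureTheory Set
open scoped ENNReal
open Literature.Probability.LatticeModels
open Literature.Probability.RandomPlanarGeometry
open Literature.Probability.RandomPlanarGeometry.SAW

namespace Summit.CriticalPhenomena.SAWScalingLimit.Theorems.FKGToTraversalBound.GatesByBubbleDoorsByFKG

variable {Ω : Set ℂ} {δ : ℝ}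

/-! ### `Z(t,t) = 1` and the splitting induction -/

/-- The only self-avoiding walk from `t` to `t` is the trivial one, of weight `x_c⁰ = 1`:
`Z_Ω(t,t) = 1`. [folklore] -/
theorem weight_self_univ (Ω : Set ℂ) (δ : ℝ) (t : Site 2) : weight Ω δ t t univ = 1 := by
  have h : (univ : Set (DomainSAW Ω δ t t)) = {DomainSAW.nil t} := by
    ext γ
    simp only [mem_univ, mem_singleton_iff, true_iff]
    obtain ⟨w, hw⟩ := γ
    obtain rfl := SimpleGraph.Walk.eq_nil_iff_nil.2 (SimpleGraph.Walk.isPath_iff_nil.1 hw)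
    rfl
  rw [h, weight_singleton, DomainSAW.length_nil, pow_zero, ENNReal.ofReal_one]

/-- **Splitting induction** (reversed-walk form): if every pair of lattice neighbours has two-point
function at most `C₀` in `Ω_δ`, then `Z_Ω(t,s) ≤ (x_c⁻¹ + C₀)^{|q|}` for every walk `q : s → t` of
`Ω_δ` — induction on `q`, peeling its first edge `s s'`:
`Z(t,s) ≤ (x_c⁻¹ + Z(s',s)) Z(t,s') ≤ (x_c⁻¹ + C₀) Z(t,s')` (`BoundaryHarnack.weight_le_of_adj`). [folklore] -/
theorem weight_univ_le_pow_of_walk_reverse {C₀ : ℝ≥0∞}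
    (hbub : ∀ u v : Site 2, (zdGraph 2).Adj u v → weight Ω δ u v univ ≤ C₀) :
    ∀ {s t : Site 2} (q : (discreteDomainGraph Ω δ).Walk s t),
      weight Ω δ t s univ ≤ ((ENNReal.ofReal criticalFugacity)⁻¹ + C₀) ^ q.length := by
  intro s t q
  induction q with
  | nil => rw [weight_self_univ, SimpleGraph.Walk.length_nil, pow_zero]
  | cons h q ih =>
    rename_i u v w
    rw [SimpleGraph.Walk.length_cons, pow_succ']
    calc weight Ω δ w u univ
        ≤ ((ENNReal.ofReal criticalFugacity)⁻¹ + weight Ω δ v u univ) * weight Ω δ w v univ :=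
          BoundaryHarnack.weight_le_of_adj Ω δ w u v h
      _ ≤ ((ENNReal.ofReal criticalFugacity)⁻¹ + C₀) *
            ((ENNReal.ofReal criticalFugacity)⁻¹ + C₀) ^ q.length := by
          gcongr
          exact hbub v u (discreteDomainGraph_le_zdGraph Ω δ h.symm)

/-- **Registered helper `gateExcision_twoPoint_le`** (crux stmt-CriticalPhenomena-1878, stub
`stub_gateExcision`): the SPLITTING INDUCTION.  If every pair of `ℤ²`-neighbours has critical two-point
function `Z_Ω(u,v) ≤ C₀` in `Ω_δ`, then `Z_Ω(t,s) ≤ (x_c⁻¹ + C₀)^{|p|}` for every walk `p : t → s` of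
`Ω_δ` (apply `weight_univ_le_pow_of_walk_reverse` to `p.reverse`). [folklore] -/
theorem gateExcision_twoPoint_le :
    ∀ (C₀ : ENNReal) (Ω : Set ℂ) (δ : ℝ),
      (∀ u v : Site 2, (zdGraph 2).Adj u v → SAW.weight Ω δ u v Set.univ ≤ C₀) →
      ∀ (t s : Site 2) (p : (discreteDomainGraph Ω δ).Walk t s),
        SAW.weight Ω δ t s Set.univ ≤ ((ENNReal.ofReal SAW.criticalFugacity)⁻¹ + C₀) ^ p.length := by
  intro C₀ Ω δ hbub t s p
  simpa only [SimpleGraph.Walk.length_reverse] using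
    weight_univ_le_pow_of_walk_reverse (Ω := Ω) (δ := δ) hbub p.reverse

/-! ### Lattice boxes: `(w+1)²` sites -/

/-- A finite set of sites of the lattice box `InBox q w` has at most `(w+1)²` elements
(`v ↦ (v 0, v 1)` injects it into `Icc (q 0) (q 0 + w) × Icc (q 1) (q 1 + w)`). [folklore] -/
theorem card_le_of_inBox {q : Site 2} {w : ℕ} {T : Finset (Site 2)} (hT : ∀ t ∈ T, InBox q w t) :
    T.card ≤ (w + 1) ^ 2 := by
  classical
  have hmaps : Set.MapsTo (fun v : Site 2 => (v 0, v 1)) (T : Set (Site 2))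
      ((Finset.Icc (q 0) (q 0 + w) ×ˢ Finset.Icc (q 1) (q 1 + w) : Finset (ℤ × ℤ)) :
        Set (ℤ × ℤ)) := by
    intro v hv
    have hv' := hT v (Finset.mem_coe.1 hv)
    simp only [Finset.coe_product, Set.mem_prod, Finset.coe_Icc, Set.mem_Icc]
    exact ⟨⟨hv'.1, hv'.2.1⟩, hv'.2.2.1, hv'.2.2.2⟩
  have hinj : Set.InjOn (fun v : Site 2 => (v 0, v 1)) (T : Set (Site 2)) := by
    intro v _ v' _ hvv'
    simp only [Prod.mk.injEq] at hvv'
    funext i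
    fin_cases i
    · exact hvv'.1
    · exact hvv'.2
  calc T.card ≤ (Finset.Icc (q 0) (q 0 + w) ×ˢ Finset.Icc (q 1) (q 1 + w)).card :=
        Finset.card_le_card_of_injOn _ hmaps hinj
    _ = (w + 1) ^ 2 := by
        rw [Finset.card_product, Int.card_Icc, Int.card_Icc]
        have h0 : (q 0 + ↑w + 1 - q 0).toNat = w + 1 := by omega
        have h1 : (q 1 + ↑w + 1 - q 1).toNat = w + 1 := by omega
        rw [h0, h1, sq]

/-- A self-avoiding walk inside the lattice box `InBox q w` has at most `(w+1)² - 1` edges (its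
`|p| + 1` distinct vertices lie among the `(w+1)²` sites of the box). [folklore] -/
theorem length_le_of_isPath_inBox {G : SimpleGraph (Site 2)} {q : Site 2} {w : ℕ}
    {t s : Site 2} {p : G.Walk t s} (hp : p.IsPath) (hbox : ∀ x ∈ p.support, InBox q w x) :
    p.length ≤ (w + 1) ^ 2 - 1 := by
  classical
  have hcard : p.support.toFinset.card ≤ (w + 1) ^ 2 :=
    card_le_of_inBox fun t ht => hbox t (List.mem_toFinset.1 ht)
  rw [List.toFinset_card_of_nodup hp.support_nodup, SimpleGraph.Walk.length_support] at hcard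
  omega

/-- **Two-point function inside a box.**  If every pair of lattice neighbours has two-point function at
most `C₀` in `Ω_δ` and `t, s` are joined by a walk of `Ω_δ` inside the lattice box `InBox q w`, then
`Z_Ω(t,s) ≤ (x_c⁻¹ + C₀)^{(w+1)² - 1}`: shortcut the walk to a self-avoiding one (`Walk.bypass`, at
most `(w+1)² - 1` edges, `length_le_of_isPath_inBox`), apply the splitting induction and use
`x_c⁻¹ + C₀ ≥ 1` (`x_c ≤ 1`). [folklore] -/
theorem weight_univ_le_pow_of_inBox {C₀ : ℝ≥0∞}
    (hbub : ∀ u v : Site 2, (zdGraph 2).Adj u v → weight Ω δ u v univ ≤ C₀)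
    {q : Site 2} {w : ℕ} {t s : Site 2} (p : (discreteDomainGraph Ω δ).Walk t s)
    (hbox : ∀ x ∈ p.support, InBox q w x) :
    weight Ω δ t s univ ≤ ((ENNReal.ofReal criticalFugacity)⁻¹ + C₀) ^ ((w + 1) ^ 2 - 1) := by
  classical
  have hone : (1 : ℝ≥0∞) ≤ (ENNReal.ofReal criticalFugacity)⁻¹ + C₀ :=
    le_add_right (ENNReal.one_le_inv.2 (ENNReal.ofReal_le_one.2 criticalFugacity_pos_lt_one'.2.le))
  calc weight Ω δ t s univ
      ≤ ((ENNReal.ofReal criticalFugacity)⁻¹ + C₀) ^ p.bypass.length :=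
        gateExcision_twoPoint_le C₀ Ω δ hbub t s p.bypass
    _ ≤ ((ENNReal.ofReal criticalFugacity)⁻¹ + C₀) ^ ((w + 1) ^ 2 - 1) :=
        pow_le_pow_right₀ hone (length_le_of_isPath_inBox p.bypass_isPath
          fun x hx => hbox x (p.support_bypass_subset_support hx))

end Summit.CriticalPhenomena.SAWScalingLimit.Theorems.FKGToTraversalBound.GatesByBubbleDoorsByFKG

end
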